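import Summits.KontsevichZagierPeriods.KontsevichZagierPeriods.Theorems.TorsionLogsNeronTorsionSector
import Summits.KontsevichZagierPeriods.KontsevichZagierPeriods.Theorems.TorsionLogsTriangleConcatenation
import Literature.NumberTheory.Transcendental.KZKernelConjectureForms

/-!
# ON-PATH LEMMA (F4) for the rung `NeronTorsionTwoPoint` — `KontsevichZagierPeriods → NeronTorsionTwoPoint`

`neronTorsionTwoPoint_of_kontsevichZagierPeriods : KontsevichZagierPeriods → NeronTorsionTwoPoint` (sorry-free):
the summit (Conjecture 1, in kernel form `ker eval = relations`, `kzKernelConjecture_iff_isRational`) implies every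
member `NeronTorsionChainFrom N'` of the rung family. The content is the VALUE COMPUTATION showing that the
two-point Néron–torsion element `X = q²•[rI(Q→P)] + p²•[rP] + (2qp)•[rW]` has a value which is a `ℤ`-combination of
logarithms of real algebraic numbers — WITHOUT any analytic theory of `σ`/`ζ`: the FLOOR (the landed primitive chain
`stub_assembly`) applied at `P` AND at `Q` (the big triangles `{e₁ < x′ < x < x_P}`, `{e₁ < x′ < x < x_Q}` exist as
representations by domination, `asmReps_exists_rep2`), soundness of the calculus (`KZ.relations_le_ker_eval_holds`),
the landed concatenation of triangles (`triangleConcatenation_proof`: big triangle = small triangle + our triangle +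
rectangle, the rectangle being a PRODUCT whose value is `(∫_{e₁}^{x_Q} x dx/√f)·(u_Q − u_P)` by Fubini), the two
torsion data and the second-kind datum of `Q`; the `η₁ω₁`- and `ϱω₁`-terms cancel identically
(`field_simp; ring`), leaving `value X = (q²c_P/q_P²) log B_P − (q²c_Q/q_Q²) log B_Q`, which the landed log calculus
(`exists_carrier_of_logFamily`) packages as `c · log B`; the kernel conjecture then puts `X − c•[rB]` in `relations`.
The degenerate member `x_Q = e₁` (forced: `N' = 2a'`, `ϱ = 0`) is the floor itself and needs no conjecture.
This is the S ⇒ Rung direction read by the forward tribunal (`on_path`); the other end of the rung is pinned to the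
PROVED floor by `Lines/NeronTorsionTwoPoint_special.lean` (`NeronTorsionChainFrom 2 ↔ NeronTorsionPrimitiveChain`),
which discharges the [nec]-trap: the rung is a consequence of S that is not a consequence of the floor and does not
give S back. Self-contained: verbatim copies of the two `def`s of `Lines/NeronTorsionTwoPoint.lean` in the namespace
`…NeronTorsionTwoPoint.OnPath`.
-/

noncomputable section

open Set MeasureTheory
open Literature.NumberTheory.Transcendental Literature.ModelTheory.ExponentialFields
open Summit.KontsevichZagierPeriods.KontsevichZagierPeriods.Cruxes.NeronTorsionSector.Translation
  (stub_assembly stub_realDictionary stub_haarReps logRep_value isAlgebraic_endpoints_of_isSemialgebraic_Ioo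
   isSemialgebraic_proj_triangle isAlgebraic_mul_of_integralRep asmObj_isSemialgebraic_rect
   exists_carrier_of_logFamily)
open Summit.KontsevichZagierPeriods.HyperbolicBloch.OffTetraSectorKernel (exists_logRep isSemialgebraic_logIvl)
open Summit.KontsevichZagierPeriods.HurwitzMicroSectors.NormalFormPrinciple.PiBox.Dilog (spB_isSemialgebraic_triangle)
open Summit.KontsevichZagierPeriods.KontsevichZagierPeriods.Theorems (triangleConcatenation_proof)

-- `Summit.KontsevichZagierPeriods.KontsevichZagierPeriods.…` is the tree's mandated layout (single-conjunct summit).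
set_option linter.dupNamespace false

namespace Summit.KontsevichZagierPeriods.KontsevichZagierPeriods.Cruxes.TorsionSectorComplete.NeronTorsionTwoPoint.OnPath

/-- FAMILY (verbatim copy of `Lines/NeronTorsionTwoPoint.lean`). -/
def NeronTorsionChainFrom (N' : ℕ) : Prop :=
  ∀ (g₂ g₃ e₁ xP yP xQ yQ ϱ : ℝ) (N a a' p q : ℕ) (f : ℝ → ℝ),
    (∀ x, f x = 4 * x ^ 3 - g₂ * x - g₃) → g₂ ^ 3 - 27 * g₃ ^ 2 ≠ 0 → f e₁ = 0 → 0 < e₁ →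
    (∀ x, e₁ < x → 0 < f x) → e₁ < xP → yP ^ 2 = f xP → 3 ≤ N → 0 < a → 2 * a < N →
    (∀ hns : (⟨0, 0, 0, -g₂ / 4, -g₃ / 4⟩ : WeierstrassCurve ℝ).toAffine.Nonsingular xP (yP / 2),
      addOrderOf (WeierstrassCurve.Affine.Point.some xP (yP / 2) hns) = N) →
    (N : ℝ) * (∫ x in Set.Ioi xP, (Real.sqrt (f x))⁻¹) = a * (2 * ∫ x in Set.Ioi e₁, (Real.sqrt (f x))⁻¹) →
    e₁ ≤ xQ → xQ < xP → yQ ^ 2 = f xQ → 2 ≤ N' → 0 < a' → 2 * a' ≤ N' →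
    (∀ hns : (⟨0, 0, 0, -g₂ / 4, -g₃ / 4⟩ : WeierstrassCurve ℝ).toAffine.Nonsingular xQ (yQ / 2),
      addOrderOf (WeierstrassCurve.Affine.Point.some xQ (yQ / 2) hns) = N') →
    (N' : ℝ) * (∫ x in Set.Ioi xQ, (Real.sqrt (f x))⁻¹) = a' * (2 * ∫ x in Set.Ioi e₁, (Real.sqrt (f x))⁻¹) →
    (∫ x in Set.Ioo e₁ xQ, x / Real.sqrt (f x)) =
      ϱ + ((a' : ℝ) / N' - 1 / 2) * ∫ x in Set.Ioi e₁, (g₂ * x + 2 * g₃) / (2 * x ^ 2 * Real.sqrt (f x)) →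
    Nat.Coprime p q → (q : ℤ) * ((a' : ℤ) * N - (a : ℤ) * N') = (p : ℤ) * ((N : ℤ) * N') →
    ∀ (rI rP : Literature.NumberTheory.Transcendental.KZ.IntegralRep 2)
      (rW : Literature.NumberTheory.Transcendental.KZ.IntegralRep 1),
    rI.domain = {z | xQ < z 1 ∧ z 1 < z 0 ∧ z 0 < xP} →
    Set.EqOn rI.integrand (fun z => z 1 / (Real.sqrt (f (z 1)) * Real.sqrt (f (z 0)))) rI.domain →
    rP.domain = {z | e₁ < z 0 ∧ e₁ < z 1} →
    Set.EqOn rP.integrand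
      (fun z => (Real.sqrt (f (z 0)))⁻¹ * ((g₂ * z 1 + 2 * g₃) / (2 * (z 1) ^ 2 * Real.sqrt (f (z 1))))) rP.domain →
    rW.domain = {t | e₁ < t 0} →
    Set.EqOn rW.integrand (fun t => ϱ / Real.sqrt (f (t 0))) rW.domain →
    ∃ (c : ℤ) (B : ℝ) (rB : Literature.NumberTheory.Transcendental.KZ.IntegralRep 1), 1 < B ∧ IsAlgebraic ℚ B ∧
    rB.domain = {t | 1 < t 0 ∧ t 0 < B} ∧ Set.EqOn rB.integrand (fun t => (t 0)⁻¹) rB.domain ∧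
    ((q : ℤ) ^ 2) • Literature.NumberTheory.Transcendental.KZ.of rI +
      ((p : ℤ) ^ 2) • Literature.NumberTheory.Transcendental.KZ.of rP +
      (2 * (q : ℤ) * p) • Literature.NumberTheory.Transcendental.KZ.of rW -
      c • Literature.NumberTheory.Transcendental.KZ.of rB ∈ Literature.NumberTheory.Transcendental.KZ.relations

/-- RUNG (verbatim copy). -/
def NeronTorsionTwoPoint : Prop := ∀ N' : ℕ, NeronTorsionChainFrom N'

/-! ### Values of product and line representations (Fubini; no integrability needed) -/

/-- Value of a plane representation whose domain is a product set and whose integrand is a product.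
[folklore] -/
theorem value_prod2 (r : KZ.IntegralRep 2) {A B : Set ℝ} {Φ Ψ : ℝ → ℝ}
    (hd : r.domain = {z | z 0 ∈ A ∧ z 1 ∈ B}) (hi : EqOn r.integrand (fun z => Φ (z 0) * Ψ (z 1)) r.domain) :
    r.value = (∫ x in A, Φ x) * (∫ y in B, Ψ y) := by
  rw [KZ.IntegralRep.value, setIntegral_congr_fun (KZ.IntegralRep.measurableSet_domain_holds r) hi, hd]
  have hpre : (MeasurableEquiv.finTwoArrow : (Fin 2 → ℝ) ≃ᵐ ℝ × ℝ) ⁻¹' (A ×ˢ B) =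
      {z : Fin 2 → ℝ | z 0 ∈ A ∧ z 1 ∈ B} := by
    ext z
    simp [MeasurableEquiv.finTwoArrow, Set.mem_prod]
  have key := (volume_preserving_finTwoArrow ℝ).setIntegral_preimage_emb
    (MeasurableEquiv.finTwoArrow (α := ℝ)).measurableEmbedding (fun y : ℝ × ℝ => Φ y.1 * Ψ y.2) (A ×ˢ B)
  rw [hpre] at key
  have hfun : ∀ z : Fin 2 → ℝ, (fun y : ℝ × ℝ => Φ y.1 * Ψ y.2) (MeasurableEquiv.finTwoArrow z) = Φ (z 0) * Ψ (z 1) := by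
    intro z
    simp [MeasurableEquiv.finTwoArrow]
  simp_rw [hfun] at key
  rw [key, Measure.volume_eq_prod, setIntegral_prod_mul]

/-- Value of a line representation. [folklore] -/
theorem value_dim1 (r : KZ.IntegralRep 1) {A : Set ℝ} {φ : ℝ → ℝ}
    (hd : r.domain = {t | t 0 ∈ A}) (hi : EqOn r.integrand (fun t => φ (t 0)) r.domain) :
    r.value = ∫ x in A, φ x := by
  rw [KZ.IntegralRep.value, setIntegral_congr_fun (KZ.IntegralRep.measurableSet_domain_holds r) hi, hd]
  have h1 := (volume_preserving_funUnique (Fin 1) ℝ).setIntegral_preimage_emb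
    (MeasurableEquiv.funUnique (Fin 1) ℝ).measurableEmbedding φ A
  rw [← h1]
  rfl

/-- The lower end point of the `ℚ`-semialgebraic half-line `{e < t}` is algebraic. [folklore] -/
theorem isAlgebraic_of_Ioi_rep {e : ℝ} (r : KZ.IntegralRep 1) (hd : r.domain = {t | e < t 0}) :
    IsAlgebraic ℚ e := by
  set E := Homeomorph.funUnique (Fin 1) ℝ with hE
  have hse : {t : Fin 1 → ℝ | e < t 0} = E ⁻¹' Ioi e := by
    ext t
    simp [hE, Fin.default_eq_zero]
  have hfr : frontier {t : Fin 1 → ℝ | e < t 0} = E ⁻¹' {e} := by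
    rw [hse, ← E.preimage_frontier, frontier_Ioi]
  refine isAlgebraic_of_mem_frontier (x := fun _ : Fin 1 => e) r.isSemialgebraic_domain ?_
  rw [hd, hfr]
  simp [hE]

/-- **Algebraicity forced by the iterated representation** (`stub_parametersAlgebraic` with a regular
lower corner `e ≥ 0`): if `rI = [e < x′ < x < x_P, x′/(√f(x′)√f(x))]` is a representation then `g₂, g₃`
are algebraic. [cite: BochnakCosteRoy1998, Prop. 2.2.6 and §2.2] -/
theorem isAlgebraic_g_of_integralRep {g₂ g₃ e xP : ℝ} {f : ℝ → ℝ} (hf : ∀ x, f x = 4 * x ^ 3 - g₂ * x - g₃)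
    (he : 0 ≤ e) (hpos : ∀ x, e < x → 0 < f x) (hxP : e < xP) (rI : KZ.IntegralRep 2)
    (hdom : rI.domain = {z | e < z 1 ∧ z 1 < z 0 ∧ z 0 < xP})
    (hint : EqOn rI.integrand (fun z => z 1 / (Real.sqrt (f (z 1)) * Real.sqrt (f (z 0)))) rI.domain) :
    IsAlgebraic ℚ g₂ ∧ IsAlgebraic ℚ g₃ := by
  obtain ⟨x₁, h01, h1P⟩ := exists_rat_btwn hxP
  obtain ⟨x₂, h12, h2P⟩ := exists_rat_btwn h1P
  obtain ⟨x₃, h23, h3P⟩ := exists_rat_btwn h2P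
  have A12 : IsAlgebraic ℚ (f x₁ * f x₂) := isAlgebraic_mul_of_integralRep he hpos rI hdom hint h01 h12 h2P
  have A13 : IsAlgebraic ℚ (f x₁ * f x₃) :=
    isAlgebraic_mul_of_integralRep he hpos rI hdom hint h01 (h12.trans h23) h3P
  have A23 : IsAlgebraic ℚ (f x₂ * f x₃) :=
    isAlgebraic_mul_of_integralRep he hpos rI hdom hint (h01.trans h12) h23 h3P
  have hf1 : f x₁ ≠ 0 := (hpos _ h01).ne'
  have hf2 : f x₂ ≠ 0 := (hpos _ (h01.trans h12)).ne'
  have hf3 : f x₃ ≠ 0 := (hpos _ ((h01.trans h12).trans h23)).ne'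
  have hsq : f x₁ ^ 2 = f x₁ * f x₂ * (f x₁ * f x₃) * (f x₂ * f x₃)⁻¹ := by
    field_simp
  have B1 : IsAlgebraic ℚ (f x₁) :=
    IsAlgebraic.of_pow two_pos (by rw [hsq]; exact (A12.mul A13).mul A23.inv)
  have B2 : IsAlgebraic ℚ (f x₂) := by
    have h : f x₂ = (f x₁)⁻¹ * (f x₁ * f x₂) := by field_simp
    rw [h]
    exact B1.inv.mul A12
  have h4 : IsAlgebraic ℚ (4 : ℝ) := by exact_mod_cast isAlgebraic_rat ℚ (4 : ℚ)
  have Hb1 : IsAlgebraic ℚ (4 * (x₁ : ℝ) ^ 3 - f x₁) := (h4.mul ((isAlgebraic_rat ℚ x₁).pow 3)).sub B1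
  have Hb2 : IsAlgebraic ℚ (4 * (x₂ : ℝ) ^ 3 - f x₂) := (h4.mul ((isAlgebraic_rat ℚ x₂).pow 3)).sub B2
  have hx12 : (x₂ : ℝ) - x₁ ≠ 0 := sub_ne_zero.2 (ne_of_gt h12)
  have hg₂ : g₂ = ((4 * (x₂ : ℝ) ^ 3 - f x₂) - (4 * (x₁ : ℝ) ^ 3 - f x₁)) * ((x₂ : ℝ) - x₁)⁻¹ := by
    rw [hf, hf, eq_mul_inv_iff_mul_eq₀ hx12]
    ring
  have G2 : IsAlgebraic ℚ g₂ := by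
    rw [hg₂]
    exact (Hb2.sub Hb1).mul ((isAlgebraic_rat ℚ x₂).sub (isAlgebraic_rat ℚ x₁)).inv
  have hg₃ : g₃ = (4 * (x₁ : ℝ) ^ 3 - f x₁) - g₂ * x₁ := by
    rw [hf]
    ring
  have G3 : IsAlgebraic ℚ g₃ := by
    rw [hg₃]
    exact Hb1.sub (G2.mul (isAlgebraic_rat ℚ x₁))
  exact ⟨G2, G3⟩

/-- A positive real algebraic number has algebraic real `n`-th roots. [folklore] -/
theorem isAlgebraic_rpow_inv_natCast {x : ℝ} (hx : 0 ≤ x) (hxa : IsAlgebraic ℚ x) {n : ℕ} (hn : 0 < n) :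
    IsAlgebraic ℚ (x ^ ((n : ℝ)⁻¹)) :=
  IsAlgebraic.of_pow hn (by rwa [Real.rpow_inv_natCast_pow hx hn.ne'])

/-- Reduced fraction `p/q` of `(N − 2a)/(2N)` (`2a ≤ N`, `0 < N`). [folklore] -/
theorem exists_reduced (N a : ℕ) (hN : 0 < N) (h2a : 2 * a ≤ N) :
    ∃ p q : ℕ, Nat.Coprime p q ∧ (q : ℤ) * ((N : ℤ) - 2 * (a : ℤ)) = (p : ℤ) * (2 * (N : ℤ)) ∧ 0 < q := by
  obtain ⟨p, q, hcop, hpqN, hq0⟩ :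
      ∃ p q : ℕ, Nat.Coprime p q ∧ q * (N - 2 * a) = p * (2 * N) ∧ 0 < q := by
    have hg0 : 0 < Nat.gcd (N - 2 * a) (2 * N) := Nat.gcd_pos_of_pos_right _ (by omega)
    refine ⟨(N - 2 * a) / Nat.gcd (N - 2 * a) (2 * N), (2 * N) / Nat.gcd (N - 2 * a) (2 * N),
      Nat.coprime_div_gcd_div_gcd hg0, ?_, ?_⟩
    · have hp' : (N - 2 * a) / Nat.gcd (N - 2 * a) (2 * N) * Nat.gcd (N - 2 * a) (2 * N) = N - 2 * a :=
        Nat.div_mul_cancel (Nat.gcd_dvd_left _ _)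
      have hq' : (2 * N) / Nat.gcd (N - 2 * a) (2 * N) * Nat.gcd (N - 2 * a) (2 * N) = 2 * N :=
        Nat.div_mul_cancel (Nat.gcd_dvd_right _ _)
      calc (2 * N) / Nat.gcd (N - 2 * a) (2 * N) * (N - 2 * a)
          = (2 * N) / Nat.gcd (N - 2 * a) (2 * N) *
              ((N - 2 * a) / Nat.gcd (N - 2 * a) (2 * N) * Nat.gcd (N - 2 * a) (2 * N)) := by rw [hp']
        _ = (N - 2 * a) / Nat.gcd (N - 2 * a) (2 * N) *
              ((2 * N) / Nat.gcd (N - 2 * a) (2 * N) * Nat.gcd (N - 2 * a) (2 * N)) := by ring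
        _ = (N - 2 * a) / Nat.gcd (N - 2 * a) (2 * N) * (2 * N) := by rw [hq']
    · exact Nat.div_pos (Nat.le_of_dvd (by omega) (Nat.gcd_dvd_right _ _)) hg0
  refine ⟨p, q, hcop, ?_, hq0⟩
  have h := congrArg (Nat.cast : ℕ → ℤ) hpqN
  push_cast [Nat.cast_sub h2a] at h
  linarith

/-! ### The on-path lemma -/

set_option maxHeartbeats 1600000 in
/-- **ON-PATH LEMMA (F4): the summit implies the rung.** -/
@[simp] theorem neronTorsionTwoPoint_of_kontsevichZagierPeriods (h : _root_.KontsevichZagierPeriods) :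
    NeronTorsionTwoPoint := by
  intro N' g₂ g₃ e₁ xP yP xQ yQ ϱ N a a' p q f hf hΔ he₁ he₁pos hfpos hxP hyP hN ha haN hordP hintP
    hxQ hxQP hyQ hN' ha' ha'N' hordQ hintQ hEtaQ hcop hpq rI rP rW hrId hrIi hrPd hrPi hrWd hrWi
  have hK : KZKernelConjecture := kzKernelConjecture_iff_isRational.mpr (KontsevichZagierPeriods_iff.mp h)
  -- the real dictionary: `ω = 2 I₀ > 0`, `x ↦ u` on the identity component
  obtain ⟨ω, X, Y, hω, hωint, -, -, -, -, -, -, -, -, -, -, hsurj, hint, -⟩ :=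
    stub_realDictionary g₂ g₃ e₁ f hf hΔ he₁ hfpos
  set I₀ : ℝ := ∫ x in Ioi e₁, (Real.sqrt (f x))⁻¹ with hI₀
  set J : ℝ := ∫ x in Ioi e₁, (g₂ * x + 2 * g₃) / (2 * x ^ 2 * Real.sqrt (f x)) with hJ
  have hI₀pos : 0 < I₀ := by linarith
  have hInt : IntegrableOn (fun t => (Real.sqrt (f t))⁻¹) (Ioi e₁) := by
    refine Integrable.of_integral_ne_zero fun h0 => ?_
    have : I₀ = 0 := h0
    linarith
  -- `[rW]` has value `ϱ I₀`; if `ϱ = 0` it is a relation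
  have hWrel : ϱ = 0 → KZ.of rW ∈ KZ.relations := fun hϱ =>
    KZ.of_mem_relations_of_eqOn_zero rW fun t ht => by
      rw [hrWi ht]
      simp [hϱ]
  have hNr : (0 : ℝ) < N := by exact_mod_cast (show 0 < N by omega)
  have hN'r : (0 : ℝ) < N' := by exact_mod_cast (show 0 < N' by omega)
  rcases hxQ.eq_or_lt with hxQe | hxQlt
  · /- DEGENERATE MEMBER `x_Q = e₁`: the first-kind datum forces `N' = 2a'`, the second-kind datum `ϱ = 0`,
       the slope datum becomes the floor's, and the floor `stub_assembly` concludes (no conjecture needed). -/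
    have h2a' : (N' : ℝ) = 2 * a' := by
      rw [← hxQe] at hintQ
      have : ((N' : ℝ) - 2 * a') * I₀ = 0 := by rw [sub_mul]; linarith
      rcases mul_eq_zero.mp this with h1 | h1
      · linarith
      · exact absurd h1 hI₀pos.ne'
    have hϱ : ϱ = 0 := by
      rw [← hxQe, Set.Ioo_self, Measure.restrict_empty, integral_zero_measure] at hEtaQ
      have hc : (a' : ℝ) / N' - 1 / 2 = 0 := by
        rw [h2a']
        have : (a' : ℝ) ≠ 0 := by exact_mod_cast ha'.ne'
        field_simp
        ring
      rw [hc, zero_mul, add_zero] at hEtaQ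
      exact hEtaQ.symm
    have hqN : (q : ℤ) * ((N : ℤ) - 2 * (a : ℤ)) = (p : ℤ) * (2 * (N : ℤ)) := by
      have h2a'Z : (N' : ℤ) = 2 * a' := by exact_mod_cast (show (N' : ℝ) = 2 * a' from h2a')
      rw [h2a'Z] at hpq
      have ha'Z : (a' : ℤ) ≠ 0 := by exact_mod_cast ha'.ne'
      have : (a' : ℤ) * ((q : ℤ) * ((N : ℤ) - 2 * (a : ℤ)) - (p : ℤ) * (2 * (N : ℤ))) = 0 := by
        linear_combination hpq
      rcases mul_eq_zero.mp this with h1 | h1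
      · exact absurd h1 ha'Z
      · linarith
    rw [← hxQe] at hrId
    obtain ⟨c, B, rB, hB1, hBalg, hrBd, hrBi, hmem⟩ := stub_assembly g₂ g₃ e₁ xP yP N a p q f hf hΔ he₁
      he₁pos hfpos hxP hyP hN ha haN hordP hintP hcop hqN rI rP hrId hrIi hrPd hrPi
    refine ⟨c, B, rB, hB1, hBalg, hrBd, hrBi, ?_⟩
    have e : ((q : ℤ) ^ 2) • KZ.of rI + ((p : ℤ) ^ 2) • KZ.of rP + (2 * (q : ℤ) * p) • KZ.of rW - c • KZ.of rB
        = (((q : ℤ) ^ 2) • KZ.of rI + ((p : ℤ) ^ 2) • KZ.of rP - c • KZ.of rB) + (2 * (q : ℤ) * p) • KZ.of rW := by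
      abel
    rw [e]
    exact add_mem hmem (AddSubgroup.zsmul_mem _ (hWrel hϱ) _)
  · /- REGULAR MEMBER `e₁ < x_Q`. -/
    -- (a) first-kind data of `Q` and `P` in the dictionary (`u ↦ ∫_{X u}^∞ dx/√f` is the identity on `(0, ω/2]`)
    obtain ⟨uQ, huQ, hXuQ⟩ := hsurj xQ hxQlt
    obtain ⟨uP, huP, hXuP⟩ := hsurj xP hxP
    have hIQ : ∫ x in Ioi xQ, (Real.sqrt (f x))⁻¹ = uQ := by
      have h1 := hint uQ ⟨huQ.1, huQ.2.le⟩
      rwa [hXuQ] at h1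
    have hIP : ∫ x in Ioi xP, (Real.sqrt (f x))⁻¹ = uP := by
      have h1 := hint uP ⟨huP.1, huP.2.le⟩
      rwa [hXuP] at h1
    have hNuQ : (N' : ℝ) * uQ = a' * (2 * I₀) := by rw [← hIQ]; exact hintQ
    have hNuP : (N : ℝ) * uP = a * (2 * I₀) := by rw [← hIP]; exact hintP
    have h2a'r : 2 * (a' : ℝ) < N' := by
      by_contra hc
      push Not at hc
      have h1 : (N' : ℝ) * uQ < N' * (ω / 2) := mul_lt_mul_of_pos_left huQ.2 hN'r
      rw [hNuQ, hωint] at h1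
      nlinarith [mul_le_mul_of_nonneg_right hc hI₀pos.le]
    have h2a' : 2 * a' < N' := by exact_mod_cast h2a'r
    have hN'3 : 3 ≤ N' := by omega
    -- (b) algebraicity of the end points and of `g₂, g₃, e₁` (read off the three given representations)
    obtain ⟨HxQ, HxP⟩ := isAlgebraic_endpoints_of_isSemialgebraic_Ioo hxQP
      (isSemialgebraic_proj_triangle rI.isSemialgebraic_domain hrId)
    obtain ⟨G2, G3⟩ := isAlgebraic_g_of_integralRep hf (he₁pos.le.trans hxQ)
      (fun x hx => hfpos x (lt_of_le_of_lt hxQ hx)) hxQP rI hrId hrIi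
    have He₁ : IsAlgebraic ℚ e₁ := isAlgebraic_of_Ioi_rep rW hrWd
    -- (c) the big triangle at `P`, the small triangle at `Q` and the rectangle, as representations
    have hBsa : IsSemialgebraic ℚ {t : Fin 1 → ℝ | t 0 ∈ Ioo e₁ xP} := isSemialgebraic_logIvl He₁ HxP
    have hidσ : IsSemialgebraicFunOn ℚ {t : Fin 1 → ℝ | t 0 ∈ Ioo e₁ xP} (fun t => (fun s : ℝ => s) (t 0)) :=
      (isSemialgebraicFunOn_aeval hBsa (MvPolynomial.X 0)).congr fun x _ => by simp
    have hplane : ∀ S : Set (Fin 2 → ℝ), IsSemialgebraic ℚ S → S ⊆ {z | e₁ < z 0 ∧ z 1 ∈ Ioo e₁ xP} →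
        ∃ r : KZ.IntegralRep 2, r.domain = S ∧
          r.integrand = fun z => (fun s : ℝ => s) (z 1) / (Real.sqrt (f (z 0)) * Real.sqrt (f (z 1))) := by
      intro S hS hSsub
      exact stub_haarReps.2 g₂ g₃ e₁ xP f (fun s : ℝ => s) (Ioo e₁ xP) S G2 G3 He₁ hf hfpos hInt
        (fun t ht => ht.1) hBsa hidσ continuous_id'.continuousOn
        (fun x hx => by rw [abs_of_pos (he₁pos.trans hx.1)]; exact hx.2.le) hS hSsub
    obtain ⟨rIP, hIPd, hIPi⟩ := hplane {z | e₁ < z 1 ∧ z 1 < z 0 ∧ z 0 < xP}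
      (spB_isSemialgebraic_triangle He₁ HxP) (fun z hz => ⟨hz.1.trans hz.2.1, hz.1, hz.2.1.trans hz.2.2⟩)
    obtain ⟨rIQ, hIQd, hIQi⟩ := hplane {z | e₁ < z 1 ∧ z 1 < z 0 ∧ z 0 < xQ}
      (spB_isSemialgebraic_triangle He₁ HxQ)
      (fun z hz => ⟨hz.1.trans hz.2.1, hz.1, (hz.2.1.trans hz.2.2).trans hxQP⟩)
    have hSRσ : IsSemialgebraic ℚ {z : Fin 2 → ℝ | e₁ < z 1 ∧ z 1 < xQ ∧ xQ < z 0 ∧ z 0 < xP} := by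
      convert asmObj_isSemialgebraic_rect HxQ HxP He₁ HxQ using 1
      ext z
      simp only [mem_setOf_eq]
      tauto
    obtain ⟨rR, hRd, hRi⟩ := hplane {z | e₁ < z 1 ∧ z 1 < xQ ∧ xQ < z 0 ∧ z 0 < xP} hSRσ
      (fun z hz => ⟨lt_of_le_of_lt hxQ hz.2.2.1, hz.1, hz.2.1.trans (hz.2.2.1.trans hz.2.2.2)⟩)
    -- (d) the landed concatenation of triangles: `[big] − [small] − [rI] − [rectangle] ∈ relations`
    have hφψ : ∀ z : Fin 2 → ℝ, (fun s : ℝ => s) (z 1) / (Real.sqrt (f (z 0)) * Real.sqrt (f (z 1))) =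
        (fun x => x / Real.sqrt (f x)) (z 1) * (fun x => (Real.sqrt (f x))⁻¹) (z 0) := fun z => by
      simp only
      ring
    have hcat := triangleConcatenation_proof e₁ xQ xP (fun x => x / Real.sqrt (f x))
      (fun x => (Real.sqrt (f x))⁻¹) hxQlt hxQP rIP rIQ rI rR hIPd hIQd hrId hRd
      (fun z _ => by rw [hIPi]; exact hφψ z) (fun z _ => by rw [hIQi]; exact hφψ z)
      (fun z hz => by rw [hrIi hz]; simp only; ring) (fun z _ => by rw [hRi]; exact hφψ z)
    -- (e) the FLOOR at `P` and at `Q`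
    have hmc : ∀ z : Fin 2 → ℝ, (fun s : ℝ => s) (z 1) / (Real.sqrt (f (z 0)) * Real.sqrt (f (z 1))) =
        z 1 / (Real.sqrt (f (z 1)) * Real.sqrt (f (z 0))) := fun z => by
      simp only
      rw [mul_comm]
    have hIPi' : EqOn rIP.integrand (fun z => z 1 / (Real.sqrt (f (z 1)) * Real.sqrt (f (z 0)))) rIP.domain :=
      fun z _ => by rw [hIPi]; exact hmc z
    have hIQi' : EqOn rIQ.integrand (fun z => z 1 / (Real.sqrt (f (z 1)) * Real.sqrt (f (z 0)))) rIQ.domain :=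
      fun z _ => by rw [hIQi]; exact hmc z
    obtain ⟨pP, qP, hcopP, hpqP, hqP0⟩ := exists_reduced N a (by omega) haN.le
    obtain ⟨pQ, qQ, hcopQ, hpqQ, hqQ0⟩ := exists_reduced N' a' (by omega) h2a'.le
    obtain ⟨cP, BP, rBP, hBP1, hBPalg, hdBP, hiBP, hprimP⟩ := stub_assembly g₂ g₃ e₁ xP yP N a pP qP f hf hΔ
      he₁ he₁pos hfpos hxP hyP hN ha haN hordP hintP hcopP hpqP rIP rP hIPd hIPi' hrPd hrPi
    obtain ⟨cQ, BQ, rBQ, hBQ1, hBQalg, hdBQ, hiBQ, hprimQ⟩ := stub_assembly g₂ g₃ e₁ xQ yQ N' a' pQ qQ f hf hΔ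
      he₁ he₁pos hfpos hxQlt hyQ hN'3 ha' h2a' hordQ hintQ hcopQ hpqQ rIQ rP hIQd hIQi' hrPd hrPi
    -- (f) values (Fubini for the products; the landed value of a log carrier)
    have hvBP : rBP.value = Real.log BP := logRep_value hBP1.le rBP hdBP hiBP
    have hvBQ : rBQ.value = Real.log BQ := logRep_value hBQ1.le rBQ hdBQ hiBQ
    have hVP : rP.value = I₀ * J :=
      value_prod2 rP (A := Ioi e₁) (B := Ioi e₁) (Φ := fun x => (Real.sqrt (f x))⁻¹)
        (Ψ := fun x => (g₂ * x + 2 * g₃) / (2 * x ^ 2 * Real.sqrt (f x))) (by rw [hrPd]; rfl) hrPi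
    have hVW : rW.value = ϱ * I₀ := by
      rw [value_dim1 rW (A := Ioi e₁) (φ := fun x => ϱ / Real.sqrt (f x)) (by rw [hrWd]; rfl) hrWi, hI₀,
        ← integral_const_mul]
      simp_rw [div_eq_mul_inv]
    have hVR : rR.value = (∫ x in Ioo xQ xP, (Real.sqrt (f x))⁻¹) * (∫ x in Ioo e₁ xQ, x / Real.sqrt (f x)) :=
      value_prod2 rR (A := Ioo xQ xP) (B := Ioo e₁ xQ) (Φ := fun x => (Real.sqrt (f x))⁻¹)
        (Ψ := fun x => x / Real.sqrt (f x))
        (by rw [hRd]; ext z; simp only [mem_setOf_eq, mem_Ioo]; tauto)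
        (fun z _ => by rw [hRi]; simp only; ring)
    have hIooQP : ∫ x in Ioo xQ xP, (Real.sqrt (f x))⁻¹ = uQ - uP := by
      have hu : ∫ x in Ioi xQ, (Real.sqrt (f x))⁻¹ =
          (∫ x in Ioo xQ xP, (Real.sqrt (f x))⁻¹) + ∫ x in Ioi xP, (Real.sqrt (f x))⁻¹ := by
        rw [← Ioc_union_Ioi_eq_Ioi hxQP.le, setIntegral_union (Ioc_disjoint_Ioi le_rfl) measurableSet_Ioi
          (hInt.mono_set (Ioc_subset_Ioi_self.trans (Ioi_subset_Ioi hxQ)))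
          (hInt.mono_set (Ioi_subset_Ioi (hxQ.trans hxQP.le))), integral_Ioc_eq_integral_Ioo]
      rw [hIQ, hIP] at hu
      linarith
    -- (g) soundness of the calculus on the two floors and on the concatenation
    have e0P : (qP : ℝ) ^ 2 * rIP.value + (pP : ℝ) ^ 2 * (I₀ * J) - cP * Real.log BP = 0 := by
      have h1 := KZ.relations_le_ker_eval_holds hprimP
      rw [AddMonoidHom.mem_ker] at h1
      simpa only [map_add, map_sub, map_zsmul, KZ.eval_of, zsmul_eq_mul, Int.cast_pow, Int.cast_natCast,
        hvBP, hVP] using h1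
    have e0Q : (qQ : ℝ) ^ 2 * rIQ.value + (pQ : ℝ) ^ 2 * (I₀ * J) - cQ * Real.log BQ = 0 := by
      have h1 := KZ.relations_le_ker_eval_holds hprimQ
      rw [AddMonoidHom.mem_ker] at h1
      simpa only [map_add, map_sub, map_zsmul, KZ.eval_of, zsmul_eq_mul, Int.cast_pow, Int.cast_natCast,
        hvBQ, hVP] using h1
    have ecat : rIP.value - rIQ.value - rI.value - rR.value = 0 := by
      have h1 := KZ.relations_le_ker_eval_holds hcat
      rw [AddMonoidHom.mem_ker] at h1
      simpa only [map_sub, KZ.eval_of] using h1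
    -- (h) the arithmetic data over `ℝ`
    have hN0r : (N : ℝ) ≠ 0 := hNr.ne'
    have hN'0r : (N' : ℝ) ≠ 0 := hN'r.ne'
    have hqP0r : (qP : ℝ) ≠ 0 := by exact_mod_cast hqP0.ne'
    have hqQ0r : (qQ : ℝ) ≠ 0 := by exact_mod_cast hqQ0.ne'
    have hpqr : (q : ℝ) * ((a' : ℝ) * N - (a : ℝ) * N') = (p : ℝ) * ((N : ℝ) * N') := by
      have h1 := congrArg (Int.cast : ℤ → ℝ) hpq
      push_cast at h1
      exact h1
    have hpqPr : (qP : ℝ) * ((N : ℝ) - 2 * a) = (pP : ℝ) * (2 * N) := by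
      have h1 := congrArg (Int.cast : ℤ → ℝ) hpqP
      push_cast at h1
      exact h1
    have hpqQr : (qQ : ℝ) * ((N' : ℝ) - 2 * a') = (pQ : ℝ) * (2 * N') := by
      have h1 := congrArg (Int.cast : ℤ → ℝ) hpqQ
      push_cast at h1
      exact h1
    -- solved forms
    have hp' : (p : ℝ) = q * ((a' : ℝ) * N - a * N') / (N * N') := by
      rw [eq_div_iff (mul_ne_zero hN0r hN'0r)]
      linarith
    have hpP' : (pP : ℝ) = qP * ((N : ℝ) - 2 * a) / (2 * N) := by
      rw [eq_div_iff (mul_ne_zero two_ne_zero hN0r)]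
      linarith
    have hpQ' : (pQ : ℝ) = qQ * ((N' : ℝ) - 2 * a') / (2 * N') := by
      rw [eq_div_iff (mul_ne_zero two_ne_zero hN'0r)]
      linarith
    have huP' : uP = 2 * a * I₀ / N := by
      rw [eq_div_iff hN0r]
      linarith
    have huQ' : uQ = 2 * a' * I₀ / N' := by
      rw [eq_div_iff hN'0r]
      linarith
    have hVIP : rIP.value = (cP * Real.log BP - (pP : ℝ) ^ 2 * (I₀ * J)) / (qP : ℝ) ^ 2 := by
      rw [eq_div_iff (pow_ne_zero 2 hqP0r)]
      linarith
    have hVIQ : rIQ.value = (cQ * Real.log BQ - (pQ : ℝ) ^ 2 * (I₀ * J)) / (qQ : ℝ) ^ 2 := by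
      rw [eq_div_iff (pow_ne_zero 2 hqQ0r)]
      linarith
    have hVI : rI.value = rIP.value - rIQ.value - rR.value := by linarith
    -- (i) THE VALUE IDENTITY: the `η₁ω₁`- and `ϱω₁`-terms cancel
    have hT : (q : ℝ) ^ 2 * rI.value + (p : ℝ) ^ 2 * (I₀ * J) + 2 * (q : ℝ) * p * (ϱ * I₀) =
        (q : ℝ) ^ 2 * cP * (((qP : ℝ) ^ 2)⁻¹ * Real.log BP) +
          -((q : ℝ) ^ 2 * cQ) * (((qQ : ℝ) ^ 2)⁻¹ * Real.log BQ) := by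
      rw [hVI, hVR, hIooQP, hEtaQ, hVIP, hVIQ, hpP', hpQ', huP', huQ', hp']
      field_simp
      ring
    -- (j) the two carriers `β₁ = B_P^{1/q_P²}`, `β₂ = B_Q^{1/q_Q²}` as log representations on `(1, βᵢ)`
    obtain ⟨β₁, hβ₁⟩ : ∃ β : ℝ, β = BP ^ (((qP ^ 2 : ℕ) : ℝ)⁻¹) := ⟨_, rfl⟩
    obtain ⟨β₂, hβ₂⟩ : ∃ β : ℝ, β = BQ ^ (((qQ ^ 2 : ℕ) : ℝ)⁻¹) := ⟨_, rfl⟩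
    have hβ₁1 : 1 ≤ β₁ := by rw [hβ₁]; exact Real.one_le_rpow hBP1.le (inv_nonneg.2 (Nat.cast_nonneg _))
    have hβ₂1 : 1 ≤ β₂ := by rw [hβ₂]; exact Real.one_le_rpow hBQ1.le (inv_nonneg.2 (Nat.cast_nonneg _))
    have hβ₁alg : IsAlgebraic ℚ β₁ := by
      rw [hβ₁]; exact isAlgebraic_rpow_inv_natCast (zero_le_one.trans hBP1.le) hBPalg (pow_pos hqP0 2)
    have hβ₂alg : IsAlgebraic ℚ β₂ := by
      rw [hβ₂]; exact isAlgebraic_rpow_inv_natCast (zero_le_one.trans hBQ1.le) hBQalg (pow_pos hqQ0 2)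
    have hlogβ₁ : Real.log β₁ = ((qP : ℝ) ^ 2)⁻¹ * Real.log BP := by
      rw [hβ₁, Real.log_rpow (zero_lt_one.trans_le hBP1.le)]
      push_cast
      ring
    have hlogβ₂ : Real.log β₂ = ((qQ : ℝ) ^ 2)⁻¹ * Real.log BQ := by
      rw [hβ₂, Real.log_rpow (zero_lt_one.trans_le hBQ1.le)]
      push_cast
      ring
    obtain ⟨r₁, hr₁d, hr₁i⟩ := exists_logRep one_pos isAlgebraic_one hβ₁alg
    obtain ⟨r₂, hr₂d, hr₂i⟩ := exists_logRep one_pos isAlgebraic_one hβ₂alg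
    have hv₁ : r₁.value = ((qP : ℝ) ^ 2)⁻¹ * Real.log BP := by
      rw [← hlogβ₁]
      exact logRep_value hβ₁1 r₁ hr₁d (fun t _ => by rw [hr₁i]; simp only [one_div])
    have hv₂ : r₂.value = ((qQ : ℝ) ^ 2)⁻¹ * Real.log BQ := by
      rw [← hlogβ₂]
      exact logRep_value hβ₂1 r₂ hr₂d (fun t _ => by rw [hr₂i]; simp only [one_div])
    -- (k) the kernel conjecture (⇐ the summit) puts `X − ε₁[r₁] − ε₂[r₂]` in `relations` …
    have hsum : ∑ i : Fin 2, (![(q : ℤ) ^ 2 * cP, -((q : ℤ) ^ 2 * cQ)] i) • KZ.of ((![r₁, r₂]) i) =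
        ((q : ℤ) ^ 2 * cP) • KZ.of r₁ + (-((q : ℤ) ^ 2 * cQ)) • KZ.of r₂ := by
      rw [Fin.sum_univ_two]
      rfl
    have hker : (((q : ℤ) ^ 2) • KZ.of rI + ((p : ℤ) ^ 2) • KZ.of rP + (2 * (q : ℤ) * p) • KZ.of rW) -
        ∑ i : Fin 2, (![(q : ℤ) ^ 2 * cP, -((q : ℤ) ^ 2 * cQ)] i) • KZ.of ((![r₁, r₂]) i) ∈ KZ.relations := by
      apply hK
      rw [hsum]
      simp only [map_sub, map_add, map_zsmul, KZ.eval_of, zsmul_eq_mul, hv₁, hv₂, hVP, hVW]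
      push_cast
      linear_combination hT
    -- … and the landed log calculus packages the two carriers as one `c · log B`
    obtain ⟨c, B, rB, hB1, hBalg, hrBd, hrBi, hmem⟩ := exists_carrier_of_logFamily
      (((q : ℤ) ^ 2) • KZ.of rI + ((p : ℤ) ^ 2) • KZ.of rP + (2 * (q : ℤ) * p) • KZ.of rW)
      (fun _ : Fin 2 => (1 : ℝ)) ![β₁, β₂] ![(q : ℤ) ^ 2 * cP, -((q : ℤ) ^ 2 * cQ)] ![r₁, r₂]
      (fun _ => one_pos) (Fin.forall_fin_two.2 ⟨hβ₁1, hβ₂1⟩) (fun _ => isAlgebraic_one)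
      (Fin.forall_fin_two.2 ⟨hβ₁alg, hβ₂alg⟩) (Fin.forall_fin_two.2 ⟨hr₁d, hr₂d⟩)
      (Fin.forall_fin_two.2 ⟨fun t _ => show r₁.integrand t = 1 / t 0 by rw [hr₁i],
        fun t _ => show r₂.integrand t = 1 / t 0 by rw [hr₂i]⟩) hker
    exact ⟨c, B, rB, hB1, hBalg, hrBd, hrBi, hmem⟩

end Summit.KontsevichZagierPeriods.KontsevichZagierPeriods.Cruxes.TorsionSectorComplete.NeronTorsionTwoPoint.OnPath

end
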